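import Summits.AtomisticToContinuum.Crystallization.Theses.HcpThetaUniversality

/-!
# Route HcpThetaUniversality — `TargetGlue`

Frame glue for route `HcpThetaUniversality` (item stmt-AtomisticToContinuum-14147): the four cruxes
`HcpThetaMaxPackings`, `LjGroundStatesNearInvSixMax`, `NearMaxGroundStatesCrystallize`,
`CrysPeriodicMinAttained` assemble the thesis `Target`, which (rev 1) is verbatim the conjunction of
their four bodies in this order. The proof is the anonymous constructor.
-/

namespace Summit.AtomisticToContinuum.Crystallization.Theorems

open Summit.AtomisticToContinuum.Crystallization.Theses.HcpThetaUniversality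

/-- `TargetGlue` holds: the thesis `Target` of route `HcpThetaUniversality` is by definition the
conjunction `HcpThetaMaxPackings ∧ LjGroundStatesNearInvSixMax ∧ NearMaxGroundStatesCrystallize ∧
CrysPeriodicMinAttained` (bodies inlined), so the four cruxes give it by the anonymous constructor. -/
theorem hcpThetaUniversality_targetGlue_proof :
    Summit.AtomisticToContinuum.Crystallization.Theses.HcpThetaUniversality.TargetGlue := by
  unfold TargetGlue
  intro h₁ h₂ h₃ h₄
  exact ⟨h₁, h₂, h₃, h₄⟩

end Summit.AtomisticToContinuum.Crystallization.Theorems
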